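import Literature.IUT.LogVolume.WildCubicExistence
import HarnessLib

/-!
# The wild-shell obstruction, unit-translate form: at the wild pair `ℚ₃(∛3) ⊗ ℚ₃(∛3)` NO translate
# `ι₁(t)·(R_I)^∼` by a unit `t` lies in `⋃ₙ ι₁(t)ⁿ·I_{v⃗}` — the Dupuy–Hilado (4.10)-bound admits no
# (Ind3)-region at a good wild place

Proof-only sequel (theorems, no definitions) of `WildShellObstruction.lean` (abc-iut cell, seat abc-iut-w5-d069:
`not_normalizedPacket_subset_logShell`, the case `t = 1`).  SETTING ([IUTchIV] Prop. 1.1–1.2, kurims p. 9–10;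
Dupuy–Hilado, arXiv:2004.13228 (pre-split text) §4 intro "`I_{v̲} = (1/2p_{v̲}) log(O^×_{v̲})`" and §4.10
(4.10) "`(O_𝕃(−P_Θ))^{Ind3}` … given locally … by `(q̲_{v̲}^{j²/2l})^ℕ · Peel^j_{v̲} I^{⊗ j+1}_{V̲}`"): `p = 3`,
`K ⊇ ℚ₃` with `[K : ℚ₃] = 3` and `π ∈ K`, `π³ = 3` (`K ≅ ℚ₃(∛3)`, wildly ramified), the two-factor packet
`V = K ⊗_{ℚ₃} K` (`|I| = 2`), its integral structure `(R_I)^∼` (`normalizedPacket`), the Dupuy–Hilado log-shell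
`I_{v⃗} = (2·3)^{−2}·(log₃𝒪_K^× ⊗ log₃𝒪_K^×)` (`logShell`), the idempotent `e₁ = (3 + π²⊗π + π⊗π²)/9 ∈ (R_I)^∼`
and the last-slot coprojection `ι₁(t) = 1 ⊗ t` (`iota … 1`, the `peel` of the real prime packets).

WHAT THIS FILE PROVES (classical `3`-adic arithmetic; nothing disputed):
* `WildCubic.norm_coord_two_le_of_mem_logUnits` — the `π²`-coordinate is integral on `log₃(𝒪_K^×)`
  (`log₃ u = c·L(1+π) + L(y')`, `L(1+π) = π − π²/2 + 1 + O(π²)`);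
* `lift_psi_coord_iota_mul_wildIdempotent` — the MIXED product functional `Φ = ψ ⊗ x₂` (`ψ = x₀ − x₁`) takes
  the value `(3t₂ − t₀)/9` at `ι₁(t)·e₁`; for a unit `t` this has absolute value `9`, whereas `‖Φ‖ ≤ 9·(1/3)·1 = 3`
  on `I_{v⃗}` — so **`ι₁(t)·e₁ ∉ I_{v⃗}` for EVERY unit `t`** (`iota_mul_wildIdempotent_not_mem_logShell`);
* **`not_iota_smul_normalizedPacket_subset_iUnion_logShell`** — for every `t ∈ K` with `‖t‖ = 1`,
  `¬ (ι₁(t)·(R_I)^∼ ⊆ ⋃ₙ ι₁(t)ⁿ·I_{v⃗})` (else `ι₁(t^{1−n})·e₁ ∈ I_{v⃗}` for some `n`);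
* `exists_wild_packet_not_iota_smul_subset_iUnion_logShell` — the `∃`-form over `E = ℚ₃⟮α⟯ ⊆ ℚ̄₃`, `α³ = 3`.

READING (numbers, no side taken): in the REAL prime packet of seat abc-iut-c312-3 (`LDHTensor.lean`,
`PrimePacket.realDHDatum`, DH normalisation) the inputs `region_subset` (`ι_j(t_Θ)·(R_I)^∼ ⊆ bare3`) and
`subset_bound` (`bare3 ⊆ ⋃ₙ ι_j(t_Θ)ⁿ·shell`, DH (4.10) with `n = 0` allowed) are JOINTLY UNSATISFIABLE in degree
`j = 1` at any pair `v⃗ = (v, v)` with `K_v ≅ ℚ₃(∛3)` and `ord_v(t_{Θ,1,v}) = 0` (a place outside `Supp P_Θ`, where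
the theta idele is a unit): NO (Ind3)-region exists there, for every choice of the idele. In MOCHIZUKI's
normalisation (`p^{−⌈d_I+a_I⌉}·log_p(R_I^×)`, `PrimePacket.minimalDHDatumM`) the minimal region always exists
([IUTchIV] Prop. 1.2 (ii)). Kernel form of row 1 of the cell's R7-C3-Q1 computation (seat abc-iut-c312-d1),
second half. Nothing here says which normalisation [IUTchIII] Thm. 3.11 (ii) (Ind3) means; no IUT statement is
asserted. [cite: Mochizuki2012, IUTchIV Prop. 1.2 (ii) p. 10] [cite: DupuyHilado2025, §4 (intro), §4.10]
-/

noncomputable section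

open Metric Set
open scoped Pointwise

namespace Literature.IUT.LogVolume

/-! ## The `π²`-coordinate on `log₃(𝒪_K^×)` and on units -/

namespace WildCubic

variable {K : Type*} [NontriviallyNormedField K] [NormedAlgebra ℚ_[3] K] {π : K}
variable (B : Module.Basis (Fin 3) ℚ_[3] K)

/-- `x₂(1) = 0`. [cite: NeukirchANT1999, Ch. II (5.5)] -/
theorem coord_two_one (hB0 : B 0 = 1) : B.coord 2 (1 : K) = 0 := by
  rw [B.coord_apply, repr_one_two B hB0]

/-- `x₂(π) = 0`. [cite: NeukirchANT1999, Ch. II (5.5)] -/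
theorem coord_two_pi (hB1 : B 1 = π) : B.coord 2 π = 0 := by
  rw [B.coord_apply, repr_pi_two B hB1]

/-- `x₂(π²) = 1`. [cite: NeukirchANT1999, Ch. II (5.5)] -/
theorem coord_two_pi_sq (hB2 : B 2 = π ^ 2) : B.coord 2 (π ^ 2) = 1 := by
  rw [B.coord_apply, repr_pi_sq_two B hB2]

/-- **`x₂(π²·t) = t₀`**: multiplication by `π²` moves the constant coordinate to the `π²`-coordinate
(`π²·(t₀ + t₁π + t₂π²) = 3t₁ + 3t₂π + t₀π²`). [cite: NeukirchANT1999, Ch. II (5.5)] -/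
theorem coord_two_pi_sq_mul (hπ : π ^ 3 = 3) (hB0 : B 0 = 1) (hB1 : B 1 = π) (hB2 : B 2 = π ^ 2) (t : K) :
    B.coord 2 (π ^ 2 * t) = B.coord 0 t := by
  have ht := eq_combo B hB0 hB1 hB2 t
  have h3 : π ^ 2 * π = (3 : ℚ_[3]) • (1 : K) := by
    rw [Algebra.smul_def, mul_one, map_ofNat, ← hπ]; ring
  have h4 : π ^ 2 * π ^ 2 = (3 : ℚ_[3]) • π := by
    rw [Algebra.smul_def, map_ofNat, ← hπ]; ring
  have hexp : π ^ 2 * t = B.repr t 0 • π ^ 2 + ((3 : ℚ_[3]) * B.repr t 1) • (1 : K) +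
      ((3 : ℚ_[3]) * B.repr t 2) • π := by
    conv_lhs => rw [ht]
    rw [mul_add, mul_add, mul_smul_comm, mul_smul_comm, mul_smul_comm, mul_one, h3, h4, smul_smul, smul_smul,
      mul_comm (B.repr t 1), mul_comm (B.repr t 2)]
  rw [hexp, map_add, map_add, map_smul, map_smul, map_smul, coord_two_pi_sq B hB2, coord_two_one B hB0,
    coord_two_pi B hB1, smul_eq_mul, smul_eq_mul, smul_eq_mul, mul_one, mul_zero, mul_zero, add_zero, add_zero,
    B.coord_apply]

variable [IsUltrametricDist K]

/-- `‖x‖ ≤ ‖π‖² ⇒ ‖x₂‖ ≤ 1` (`‖x₂‖·‖π‖² ≤ ‖x‖`). [cite: NeukirchANT1999, Ch. II (5.5)] -/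
theorem norm_coord_two_le_of_norm_le_sq (hπ : π ^ 3 = 3) (hB0 : B 0 = 1) (hB1 : B 1 = π)
    (hB2 : B 2 = π ^ 2) {x : K} (hx : ‖x‖ ≤ ‖π‖ ^ 2) : ‖B.coord 2 x‖ ≤ 1 := by
  obtain ⟨-, -, h2⟩ := norm_repr_le B hπ hB0 hB1 hB2 x
  rw [B.coord_apply]
  have hπ2 : 0 < ‖π‖ ^ 2 := pow_pos (norm_pi_pos hπ) 2
  have h : ‖B.repr x 2‖ * ‖π‖ ^ 2 ≤ 1 * ‖π‖ ^ 2 := by rw [one_mul]; exact h2.trans hx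
  exact le_of_mul_le_mul_right h hπ2

/-- **A unit has integral `π²`-coordinate**: `‖t‖ = 1 ⇒ ‖t₂‖ ≤ 1` (`‖t₂‖·‖π‖² ≤ 1` and the absolute value
`‖t₂‖·‖π‖²` is never `1`). [cite: NeukirchANT1999, Ch. II (5.5)] -/
theorem norm_coord_two_le_one_of_norm_eq_one (hπ : π ^ 3 = 3) (hB0 : B 0 = 1) (hB1 : B 1 = π)
    (hB2 : B 2 = π ^ 2) {t : K} (ht : ‖t‖ = 1) : ‖B.coord 2 t‖ ≤ 1 := by
  have h := norm_repr_le B hπ hB0 hB1 hB2 t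
  rw [B.coord_apply]
  refine padicNorm_le_one_of_mul_norm_pi_sq_lt hπ (lt_of_le_of_ne (h.2.2.trans_eq ht) ?_)
  intro heq
  by_cases hz : B.repr t 2 = 0
  · rw [hz, norm_zero, zero_mul] at heq; norm_num at heq
  · have hne := norm_smul_pi_pow_ne hπ hz (one_ne_zero (α := ℚ_[3])) (i := 2) (j := 0)
      (by norm_num) (by norm_num) (by norm_num)
    rw [norm_one, pow_zero, mul_one] at hne
    exact hne heq

/-- **A unit has unit constant coordinate**: `‖t‖ = 1 ⇒ ‖t₀‖ = 1` (`t ≡ ±1 (mod 𝔪)`: `‖1 − (±t)‖ < 1`, so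
`‖1 − (±t₀)‖ < 1 = ‖1‖` and the ultrametric inequality forces `‖t₀‖ = 1`). [cite: NeukirchANT1999, Ch. II (5.5)] -/
theorem norm_coord_zero_eq_one_of_norm_eq_one (hπ : π ^ 3 = 3) (hB0 : B 0 = 1) (hB1 : B 1 = π)
    (hB2 : B 2 = π ^ 2) {t : K} (ht : ‖t‖ = 1) : ‖B.coord 0 t‖ = 1 := by
  obtain ⟨s, hs, hP⟩ := exists_sign_isPrincipal B hπ hB0 hB1 hB2 ht
  rw [isPrincipal_iff] at hP
  obtain ⟨h0, -, -⟩ := norm_repr_le B hπ hB0 hB1 hB2 (1 - s * t)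
  have hlt : ‖B.repr (1 - s * t) 0‖ < 1 := h0.trans_lt hP
  have hs' : ∃ σ : ℚ_[3], ‖σ‖ = 1 ∧ s = algebraMap ℚ_[3] K σ := by
    rcases hs with rfl | rfl
    · exact ⟨1, by simp, by rw [map_one]⟩
    · exact ⟨-1, by simp, by rw [map_neg, map_one]⟩
  obtain ⟨σ, hσ1, rfl⟩ := hs'
  have hrepr : B.repr (1 - algebraMap ℚ_[3] K σ * t) 0 = 1 + -(σ * B.repr t 0) := by
    rw [← Algebra.smul_def, map_sub, map_smul, Finsupp.sub_apply, Finsupp.smul_apply, repr_one_zero B hB0,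
      smul_eq_mul, sub_eq_add_neg]
  rw [hrepr] at hlt
  rw [B.coord_apply]
  -- ultrametric: `‖1 + (−σ t₀)‖ < 1 = ‖1‖` forces `‖σ t₀‖ = 1`
  have hkey : ‖-(σ * B.repr t 0)‖ = 1 := by
    by_contra hne
    have hne' : ‖(1 : ℚ_[3])‖ ≠ ‖-(σ * B.repr t 0)‖ := by rw [norm_one]; exact fun h => hne h.symm
    have hmax := IsUltrametricDist.norm_add_eq_max_of_norm_ne_norm hne'
    rw [norm_one] at hmax
    have h1 : (1 : ℝ) ≤ ‖1 + -(σ * B.repr t 0)‖ := by rw [hmax]; exact le_max_left _ _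
    linarith
  rwa [norm_neg, norm_mul, hσ1, one_mul] at hkey

variable [CompleteSpace K]

/-- `‖x₂(L(1+π))‖ ≤ 1`: `L(1+π) = π − π²/2 + 1 + R` with `‖R‖ ≤ ‖π‖²`, so `x₂(L(1+π)) = −1/2 + x₂(R)`.
[cite: NeukirchANT1999, Ch. II (5.5)] -/
theorem norm_coord_two_logSeries_one_add_pi_le (hπ : π ^ 3 = 3) (hB0 : B 0 = 1) (hB1 : B 1 = π)
    (hB2 : B 2 = π ^ 2) : ‖B.coord 2 (logSeries (1 + π))‖ ≤ 1 := by
  obtain ⟨R, hR, hL⟩ := logSeries_one_add_pi hπ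
  have hdiv : -(π ^ 2) / (2 : K) = (2 : ℚ_[3])⁻¹ • (-(π ^ 2)) := by
    rw [Algebra.smul_def, map_inv₀, map_ofNat, div_eq_inv_mul]
  rw [hL, map_add, map_add, map_add, hdiv, map_smul, map_neg, coord_two_one B hB0, coord_two_pi B hB1,
    coord_two_pi_sq B hB2, zero_add, add_zero, smul_eq_mul, mul_neg, mul_one]
  refine (IsUltrametricDist.norm_add_le_max _ _).trans (max_le ?_ ?_)
  · rw [norm_neg, norm_inv]
    have h2 : ‖(2 : ℚ_[3])‖ = 1 := by
      have h := (Padic.norm_natCast_eq_one_iff (p := 3) (n := 2)).mpr (by norm_num)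
      simpa using h
    rw [h2, inv_one]
  · exact norm_coord_two_le_of_norm_le_sq B hπ hB0 hB1 hB2 hR

/-- **`‖x₂(log₃ u)‖ ≤ 1` for every unit `u`**: `log₃ u = c·L(1+π) + L(y')` with `‖1 − y'‖ ≤ ‖π‖²`
(units are `±(1+π)^c·y'`), and both summands have integral `π²`-coordinate. [cite: NeukirchANT1999, Ch. II (5.5)] -/
theorem norm_coord_two_unitLog_le [ProperSpace K] (hπ : π ^ 3 = 3) (hB0 : B 0 = 1) (hB1 : B 1 = π)
    (hB2 : B 2 = π ^ 2) {u : K} (hu : ‖u‖ = 1) : ‖B.coord 2 (unitLog u)‖ ≤ 1 := by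
  obtain ⟨s, hs, hP⟩ := exists_sign_isPrincipal B hπ hB0 hB1 hB2 hu
  have hss : s * s = 1 := by rcases hs with rfl | rfl <;> norm_num
  have hs1 : ‖s‖ = 1 := by rcases hs with rfl | rfl <;> simp
  have hsu : ‖s * u‖ = 1 := by rw [norm_mul, hs1, hu, one_mul]
  have hlog : unitLog u = logSeries (s * u) := by
    have h1 : unitLog (s * (s * u)) = unitLog s + unitLog (s * u) := unitLog_mul 3 hs1 hsu
    rw [← mul_assoc, hss, one_mul] at h1
    rw [h1, unitLog_eq_zero_of_pow_eq_one 3 two_pos (by rw [pow_two, hss]), zero_add,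
      unitLog_of_isPrincipal 3 hP]
  obtain ⟨c, -, hle⟩ := exists_pow_sub_norm_le B hπ hB0 hB1 hB2 hP
  have hP1 : IsPrincipal (1 + π) := by
    rw [isPrincipal_iff, show (1 : K) - (1 + π) = -π by ring, norm_neg]
    exact norm_pi_lt_one hπ
  have hPw : IsPrincipal ((1 + π) ^ c) := hP1.pow c
  have hw1 : ‖(1 + π) ^ c‖ = 1 := hPw.norm_eq_one
  have hw0 : (1 + π) ^ c ≠ 0 := norm_pos_iff.mp (by rw [hw1]; norm_num)
  have hy'1 : ‖1 - ((1 + π) ^ c)⁻¹ * (s * u)‖ ≤ ‖π‖ ^ 2 := by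
    have e : 1 - ((1 + π) ^ c)⁻¹ * (s * u) = ((1 + π) ^ c)⁻¹ * ((1 + π) ^ c - s * u) := by
      rw [mul_sub, inv_mul_cancel₀ hw0]
    rw [e, norm_mul, norm_inv, hw1, inv_one, one_mul]
    exact hle
  have hPy' : IsPrincipal (((1 + π) ^ c)⁻¹ * (s * u)) :=
    lt_of_le_of_lt hy'1 (norm_pi_sq_lt_one hπ)
  have hdec : s * u = (1 + π) ^ c * (((1 + π) ^ c)⁻¹ * (s * u)) := by
    rw [mul_inv_cancel_left₀ hw0]
  have hL : logSeries (s * u) =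
      (c : ℚ_[3]) • logSeries (1 + π) + logSeries (((1 + π) ^ c)⁻¹ * (s * u)) := by
    rw [hdec, logSeries_mul 3 hPw hPy', logSeries_pow 3 hP1, ← hdec, Algebra.smul_def, map_natCast]
  rw [hlog, hL, map_add, map_smul]
  refine (IsUltrametricDist.norm_add_le_max _ _).trans (max_le ?_ ?_)
  · rw [norm_smul]
    have hc1 : ‖(c : ℚ_[3])‖ ≤ 1 := by
      have h := Padic.norm_int_le_one (p := 3) (c : ℤ)
      rwa [Int.cast_natCast] at h
    calc ‖(c : ℚ_[3])‖ * ‖B.coord 2 (logSeries (1 + π))‖ ≤ 1 * 1 := by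
          gcongr
          exact norm_coord_two_logSeries_one_add_pi_le B hπ hB0 hB1 hB2
      _ = 1 := one_mul _
  · exact norm_coord_two_le_of_norm_le_sq B hπ hB0 hB1 hB2 (norm_logSeries_le_of_norm_le hπ hy'1)

/-- **`x₂` is integral on `log₃(𝒪_K^×)`** (`logUnits K`, abc-iut-S1). [cite: NeukirchANT1999, Ch. II (5.5)] -/
theorem norm_coord_two_le_of_mem_logUnits [ProperSpace K] (hπ : π ^ 3 = 3) (hB0 : B 0 = 1)
    (hB1 : B 1 = π) (hB2 : B 2 = π ^ 2) {z : K} (hz : z ∈ logUnits K) : ‖B.coord 2 z‖ ≤ 1 := by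
  obtain ⟨u, hu, rfl⟩ := mem_logUnits_iff.mp hz
  exact norm_coord_two_unitLog_le B hπ hB0 hB1 hB2 hu

end WildCubic

/-! ## The unit translates `ι₁(t)·e₁` of the idempotent escape the log-shell -/

section Wild

variable {K : Type} [NontriviallyNormedField K] [NormedAlgebra ℚ_[3] K] {π : K}

/-- `ι₁(t) = 1 ⊗ t` as a pure tensor of the two-factor packet. [cite: Mochizuki2012, IUTchIV Prop. 1.1 p. 9] -/
theorem iota_one_eq_purePacket_pair (t : K) :
    iota 3 (fun _ : Fin 2 => K) 1 t = purePacket 3 (fun _ : Fin 2 => K) ![1, t] := by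
  rw [iota_eq_purePacket]
  congr 1
  funext i
  fin_cases i <;> simp

/-- `ι₁(t)·(3 + π²⊗π + π⊗π²) = 3·(1⊗t) + π²⊗(πt) + π⊗(π²t)`. [cite: Mochizuki2012, IUTchIV Prop. 1.1 p. 9] -/
theorem iota_one_mul_wildNumerator (t : K) :
    iota 3 (fun _ : Fin 2 => K) 1 t *
        ((3 : PacketAlgebra 3 (fun _ : Fin 2 => K)) + purePacket 3 (fun _ : Fin 2 => K) ![π ^ 2, π]
          + purePacket 3 (fun _ : Fin 2 => K) ![π, π ^ 2]) =
      (3 : ℚ_[3]) • purePacket 3 (fun _ : Fin 2 => K) ![1, t] + purePacket 3 (fun _ : Fin 2 => K) ![π ^ 2, π * t]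
        + purePacket 3 (fun _ : Fin 2 => K) ![π, π ^ 2 * t] := by
  have h3 : (3 : PacketAlgebra 3 (fun _ : Fin 2 => K)) = (3 : ℚ_[3]) • purePacket 3 (fun _ : Fin 2 => K) ![1, 1] := by
    have hone : (![(1 : K), 1] : Fin 2 → K) = 1 := by funext i; fin_cases i <;> rfl
    rw [hone, purePacket_one, Algebra.smul_def, mul_one, map_ofNat]
  rw [iota_one_eq_purePacket_pair, mul_add, mul_add, h3, mul_smul_comm, purePacket_pair_mul, purePacket_pair_mul,
    purePacket_pair_mul, one_mul, one_mul, one_mul, mul_one, mul_comm t π, mul_comm t (π ^ 2)]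

/-- **The mixed functional `Φ = ψ ⊗ x₂` at `ι₁(t)·e₁`**: `Φ(ι₁(t)·e₁) = (3t₂ − t₀)/9`
(`ψ(1) = 1`, `ψ(π²) = 0`, `ψ(π) = −1`, `x₂(π²t) = t₀`). [cite: Mochizuki2012, IUTchIV Prop. 1.1 p. 9] -/
theorem lift_psi_coord_iota_mul_wildIdempotent (hπ : π ^ 3 = 3) (B : Module.Basis (Fin 3) ℚ_[3] K)
    (hB0 : B 0 = 1) (hB1 : B 1 = π) (hB2 : B 2 = π ^ 2) (t : K) :
    PiTensorProduct.lift ((MultilinearMap.mkPiAlgebra ℚ_[3] (Fin 2) ℚ_[3]).compLinearMap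
        (![B.coord 0 - B.coord 1, B.coord 2] : ∀ _ : Fin 2, K →ₗ[ℚ_[3]] ℚ_[3]))
      (iota 3 (fun _ : Fin 2 => K) 1 t *
        ((9 : ℚ_[3])⁻¹ • ((3 : PacketAlgebra 3 (fun _ : Fin 2 => K)) + purePacket 3 (fun _ : Fin 2 => K) ![π ^ 2, π]
          + purePacket 3 (fun _ : Fin 2 => K) ![π, π ^ 2]))) =
      (9 : ℚ_[3])⁻¹ * (3 * B.coord 2 t - B.coord 0 t) := by
  have hΦ : ∀ x y : K, PiTensorProduct.lift ((MultilinearMap.mkPiAlgebra ℚ_[3] (Fin 2) ℚ_[3]).compLinearMap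
      (![B.coord 0 - B.coord 1, B.coord 2] : ∀ _ : Fin 2, K →ₗ[ℚ_[3]] ℚ_[3]))
        (purePacket 3 (fun _ : Fin 2 => K) ![x, y]) = (B.coord 0 - B.coord 1) x * B.coord 2 y := by
    intro x y
    rw [purePacket, PiTensorProduct.lift.tprod, MultilinearMap.compLinearMap_apply,
      MultilinearMap.mkPiAlgebra_apply, Fin.prod_univ_two]
    simp
  rw [mul_smul_comm, map_smul, iota_one_mul_wildNumerator, map_add, map_add, map_smul, hΦ, hΦ, hΦ,
    WildCubic.psi_one B hB0, WildCubic.psi_pi B hB1, WildCubic.psi_pi_sq B hB2,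
    WildCubic.coord_two_pi_sq_mul B hπ hB0 hB1 hB2 t, smul_eq_mul, smul_eq_mul]
  ring

/-- `‖9‖₃ = 1/9`. [cite: NeukirchANT1999, Ch. II (5.5)] -/
theorem padicNorm_nine : ‖(9 : ℚ_[3])‖ = 9⁻¹ := by
  have : (9 : ℚ_[3]) = (3 : ℚ_[3]) ^ 2 := by norm_num
  rw [this, norm_pow]
  have h3 : ‖(3 : ℚ_[3])‖ = 3⁻¹ := by simpa using Padic.norm_p (p := 3)
  rw [h3]; norm_num

/-- … so for a UNIT `t` it has absolute value `9` (`‖t₀‖ = 1 > 1/3 ≥ ‖3t₂‖`). [cite: NeukirchANT1999, Ch. II (5.5)] -/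
theorem norm_lift_psi_coord_iota_mul_wildIdempotent [IsUltrametricDist K] (hπ : π ^ 3 = 3)
    (B : Module.Basis (Fin 3) ℚ_[3] K) (hB0 : B 0 = 1) (hB1 : B 1 = π) (hB2 : B 2 = π ^ 2) {t : K}
    (ht : ‖t‖ = 1) :
    ‖PiTensorProduct.lift ((MultilinearMap.mkPiAlgebra ℚ_[3] (Fin 2) ℚ_[3]).compLinearMap
        (![B.coord 0 - B.coord 1, B.coord 2] : ∀ _ : Fin 2, K →ₗ[ℚ_[3]] ℚ_[3]))
      (iota 3 (fun _ : Fin 2 => K) 1 t *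
        ((9 : ℚ_[3])⁻¹ • ((3 : PacketAlgebra 3 (fun _ : Fin 2 => K)) + purePacket 3 (fun _ : Fin 2 => K) ![π ^ 2, π]
          + purePacket 3 (fun _ : Fin 2 => K) ![π, π ^ 2])))‖ = 9 := by
  rw [lift_psi_coord_iota_mul_wildIdempotent hπ B hB0 hB1 hB2 t, norm_mul, norm_inv, padicNorm_nine, inv_inv]
  have h0 : ‖B.coord 0 t‖ = 1 := WildCubic.norm_coord_zero_eq_one_of_norm_eq_one B hπ hB0 hB1 hB2 ht
  have h2 : ‖B.coord 2 t‖ ≤ 1 := WildCubic.norm_coord_two_le_one_of_norm_eq_one B hπ hB0 hB1 hB2 ht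
  have hlt : ‖-(B.coord 0 t)‖ ≠ ‖3 * B.coord 2 t‖ := by
    rw [norm_neg, h0, norm_mul]
    have h3 : ‖(3 : ℚ_[3])‖ = 3⁻¹ := by simpa using Padic.norm_p (p := 3)
    rw [h3]
    have : 3⁻¹ * ‖B.coord 2 t‖ < 1 :=
      calc 3⁻¹ * ‖B.coord 2 t‖ ≤ 3⁻¹ * 1 := by gcongr
        _ < 1 := by norm_num
    exact this.ne'
  have hval : ‖3 * B.coord 2 t - B.coord 0 t‖ = 1 := by
    rw [sub_eq_neg_add, IsUltrametricDist.norm_add_eq_max_of_norm_ne_norm hlt, norm_neg, h0, max_eq_left]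
    rw [norm_mul]
    have h3 : ‖(3 : ℚ_[3])‖ = 3⁻¹ := by simpa using Padic.norm_p (p := 3)
    rw [h3]
    calc 3⁻¹ * ‖B.coord 2 t‖ ≤ 3⁻¹ * 1 := by gcongr
      _ ≤ 1 := by norm_num
  rw [hval, mul_one]

/-- **`ι₁(t)·e₁ ∉ I_{v⃗}` for every unit `t`** (`‖ψ ⊗ x₂‖ ≤ 9·(1/3)·1 = 3` on `I_{v⃗}`, `= 9` at `ι₁(t)·e₁`).
[cite: DupuyHilado2025, §4 (intro)] [cite: Mochizuki2012, IUTchIV Prop. 1.2 (ii) p. 10] -/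
theorem iota_mul_wildIdempotent_not_mem_logShell [IsUltrametricDist K] [ProperSpace K] (hπ : π ^ 3 = 3)
    (B : Module.Basis (Fin 3) ℚ_[3] K) (hB0 : B 0 = 1) (hB1 : B 1 = π) (hB2 : B 2 = π ^ 2) {t : K}
    (ht : ‖t‖ = 1) :
    iota 3 (fun _ : Fin 2 => K) 1 t *
        ((9 : ℚ_[3])⁻¹ • ((3 : PacketAlgebra 3 (fun _ : Fin 2 => K)) + purePacket 3 (fun _ : Fin 2 => K) ![π ^ 2, π]
          + purePacket 3 (fun _ : Fin 2 => K) ![π, π ^ 2])) ∉ logShell 3 (fun _ : Fin 2 => K) := by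
  intro hmem
  have hle := norm_lift_prod_le_of_mem_logShell 3 (fun _ : Fin 2 => K)
    (![B.coord 0 - B.coord 1, B.coord 2] : ∀ _ : Fin 2, K →ₗ[ℚ_[3]] ℚ_[3]) ![3⁻¹, 1]
    (fun i => by fin_cases i <;> norm_num [Matrix.cons_val_one, Matrix.head_cons])
    (fun i z hz => by
      fin_cases i
      · simpa using WildCubic.norm_psi_le_of_mem_logUnits B hπ hB0 hB1 hB2 hz
      · simpa using WildCubic.norm_coord_two_le_of_mem_logUnits B hπ hB0 hB1 hB2 hz) hmem
  rw [norm_lift_psi_coord_iota_mul_wildIdempotent hπ B hB0 hB1 hB2 ht, norm_shellScalar_three_two,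
    Fin.prod_univ_two] at hle
  norm_num [Matrix.cons_val_one, Matrix.head_cons] at hle

/-- Iterates of a left multiplication are left multiplications by powers. [folklore] -/
private theorem iterate_mul_left_apply {R : Type*} [Monoid R] (a x : R) (n : ℕ) :
    (fun y => a * y)^[n] x = a ^ n * x := by
  induction n with
  | zero => simp
  | succ n ih => rw [Function.iterate_succ_apply', ih, pow_succ', mul_assoc]

/-- **WILD-SHELL OBSTRUCTION, UNIT-TRANSLATE FORM (basis version).** For every `t ∈ K` with `‖t‖ = 1`:
`¬ (ι₁(t)·(R_I)^∼ ⊆ ⋃ₙ ι₁(t)ⁿ·I_{v⃗})` — the Dupuy–Hilado (4.10)-shaped bound (with `n = 0` allowed) admits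
no (Ind3)-region containing the unit translate `ι₁(t)·(R_I)^∼` of the integral structure.
[cite: DupuyHilado2025, §4.10] [cite: Mochizuki2012, IUTchIV Prop. 1.2 (ii) p. 10] -/
theorem not_iota_smul_normalizedPacket_subset_iUnion_logShell_of_basis [IsUltrametricDist K] [ProperSpace K]
    (hπ : π ^ 3 = 3) (B : Module.Basis (Fin 3) ℚ_[3] K) (hB0 : B 0 = 1) (hB1 : B 1 = π) (hB2 : B 2 = π ^ 2)
    {t : K} (ht : ‖t‖ = 1) :
    ¬ (iota 3 (fun _ : Fin 2 => K) 1 t • (normalizedPacket 3 (fun _ : Fin 2 => K) : Set (PacketAlgebra 3 (fun _ : Fin 2 => K)))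
        ⊆ ⋃ n : ℕ, (fun x => iota 3 (fun _ : Fin 2 => K) 1 t * x)^[n] '' logShell 3 (fun _ : Fin 2 => K)) := by
  intro hsub
  set e₁ := (9 : ℚ_[3])⁻¹ • ((3 : PacketAlgebra 3 (fun _ : Fin 2 => K)) + purePacket 3 (fun _ : Fin 2 => K) ![π ^ 2, π]
      + purePacket 3 (fun _ : Fin 2 => K) ![π, π ^ 2]) with he₁
  set ι := iota 3 (fun _ : Fin 2 => K) 1 with hι
  have hmem : ι t * e₁ ∈ ι t • (normalizedPacket 3 (fun _ : Fin 2 => K) : Set (PacketAlgebra 3 (fun _ : Fin 2 => K))) :=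
    Set.smul_mem_smul_set (wildIdempotent_mem_normalizedPacket hπ)
  obtain ⟨n, hn⟩ := Set.mem_iUnion.mp (hsub hmem)
  obtain ⟨s, hs, hns⟩ := hn
  rw [iterate_mul_left_apply] at hns
  -- `s = ι(t⁻¹)ⁿ · ι(t) · e₁ = ι(t⁻¹ ^ n * t) · e₁`, a unit translate of `e₁`
  have ht0 : t ≠ 0 := norm_pos_iff.mp (by rw [ht]; exact one_pos)
  have hinv : ι t⁻¹ * ι t = 1 := by rw [← map_mul, inv_mul_cancel₀ ht0, map_one]
  have hs_eq : s = ι (t⁻¹ ^ n * t) * e₁ :=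
    calc s = (ι t⁻¹ * ι t) ^ n * s := by rw [hinv, one_pow, one_mul]
      _ = ι t⁻¹ ^ n * (ι t ^ n * s) := by rw [mul_pow, mul_assoc]
      _ = ι t⁻¹ ^ n * (ι t * e₁) := by rw [hns]
      _ = ι (t⁻¹ ^ n * t) * e₁ := by rw [map_mul, map_pow, mul_assoc]
  have hunit : ‖t⁻¹ ^ n * t‖ = 1 := by rw [norm_mul, norm_pow, norm_inv, ht, inv_one, one_pow, one_mul]
  rw [hs_eq] at hs
  exact iota_mul_wildIdempotent_not_mem_logShell hπ B hB0 hB1 hB2 hunit hs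

/-- **WILD-SHELL OBSTRUCTION, UNIT-TRANSLATE FORM.** Let `K ⊇ ℚ₃` be a field with `[K : ℚ₃] = 3` containing `π`
with `π³ = 3`, and consider the two-factor packet `K ⊗_{ℚ₃} K` with its Dupuy–Hilado log-shell
`I_{v⃗} = (2·3)^{−2}·log₃(R_I^×)`. Then for EVERY `t ∈ K` with `‖t‖ = 1`:
`ι₁(t)·(R_I)^∼ ⊄ ⋃_{n ∈ ℕ} ι₁(t)ⁿ·I_{v⃗}`.  Consequently the (4.10)-shaped bound
`bare3 ⊆ ⋃ₙ peel(t_Θ)ⁿ(shell)` TOGETHER WITH `peel(t_Θ)·(R_I)^∼ ⊆ bare3` has no solution `bare3` at this packet when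
the last-slot idele `t_Θ` is a unit (a place outside the support of the theta pilot divisor) — in the DH
normalisation; in Mochizuki's (`p^{−⌈d_I+a_I⌉}·log_p(R_I^×)`, [IUTchIV] Prop. 1.2 (ii)) the minimal region
`peel(t_Θ)·(R_I)^∼` always qualifies. No side taken on [IUTchIII] Cor. 3.12.
[cite: DupuyHilado2025, §4.10] [cite: Mochizuki2012, IUTchIV Prop. 1.2 (ii) p. 10] -/
theorem not_iota_smul_normalizedPacket_subset_iUnion_logShell [IsUltrametricDist K] [ProperSpace K]
    (hK : Module.finrank ℚ_[3] K = 3) (hπ : π ^ 3 = 3) {t : K} (ht : ‖t‖ = 1) :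
    ¬ (iota 3 (fun _ : Fin 2 => K) 1 t • (normalizedPacket 3 (fun _ : Fin 2 => K) : Set (PacketAlgebra 3 (fun _ : Fin 2 => K)))
        ⊆ ⋃ n : ℕ, (fun x => iota 3 (fun _ : Fin 2 => K) 1 t * x)^[n] '' logShell 3 (fun _ : Fin 2 => K)) := by
  have hli := WildCubic.linearIndependent_one_pi_pi_sq hπ
  let B := basisOfLinearIndependentOfCardEqFinrank hli (by rw [hK, Fintype.card_fin])
  have hB : ⇑B = ![(1 : K), π, π ^ 2] := coe_basisOfLinearIndependentOfCardEqFinrank _ _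
  have hB0 : B 0 = 1 := by rw [hB]; rfl
  have hB1 : B 1 = π := by rw [hB]; rfl
  have hB2 : B 2 = π ^ 2 := by rw [hB]; rfl
  exact not_iota_smul_normalizedPacket_subset_iUnion_logShell_of_basis hπ B hB0 hB1 hB2 ht

end Wild

/-! ## Non-vacuity: the wild cubic field exists inside `ℚ̄₃` -/

section Existence

open IntermediateField

/-- **`∃`-form**: there is a cubic subfield `E = ℚ₃⟮α⟯ ⊆ ℚ̄₃`, `α³ = 3`, such that for EVERY unit `t` of `E` the
unit translate `ι₁(t)·(R_I)^∼` of the two-factor packet `E ⊗_{ℚ₃} E` is not contained in `⋃ₙ ι₁(t)ⁿ·I_{v⃗}`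
(all instances inferred; `exists_wildCubic_subfield`). [cite: DupuyHilado2025, §4.10]
[cite: Mochizuki2012, IUTchIV Prop. 1.2 (ii) p. 10] -/
theorem exists_wild_packet_not_iota_smul_subset_iUnion_logShell :
    ∃ (E : IntermediateField ℚ_[3] (PadicAlgCl 3)) (_ : FiniteDimensional ℚ_[3] E),
      ∀ t : E, ‖t‖ = 1 →
        ¬ (iota 3 (fun _ : Fin 2 => (E : Type)) 1 t •
              (normalizedPacket 3 (fun _ : Fin 2 => (E : Type)) : Set (PacketAlgebra 3 (fun _ : Fin 2 => (E : Type))))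
            ⊆ ⋃ n : ℕ, (fun x => iota 3 (fun _ : Fin 2 => (E : Type)) 1 t * x)^[n] ''
                logShell 3 (fun _ : Fin 2 => (E : Type))) := by
  obtain ⟨E, π, hfd, hK, hπ⟩ := exists_wildCubic_subfield
  haveI : FiniteDimensional ℚ_[3] E := hfd
  exact ⟨E, hfd, fun t ht => not_iota_smul_normalizedPacket_subset_iUnion_logShell hK hπ ht⟩

end Existence

end Literature.IUT.LogVolume

end
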